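import Literature.Geometry.Kaehler.ComplexTorusDivisorMultiplicityStrata
import HarnessLib

/-!
# `mult_C(D) = min_{x ∈ C} mult_x(D)`: the multiplicity of a component is the generic (minimal) point
# multiplicity; a component lies in `{mult ≥ k}` iff `mult_C(D) ≥ k`; `Sing` of a reduced divisor contains
# no component (`N_{g−1,g} = ∅`)

[tag: lange-cav-complex-tori] [linked: HodgeConjecture (lit-hodgefound SKELETON §A2, row A2-177)]

Layer `Literature/Geometry/Kaehler`, namespace `Literature.Geometry.Kaehler.ComplexTorus`; lane
`lit-hodgefound` (Track 2 foundations library), skeleton seat `lit-hodgefound-skel-2` (generation 40), plan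
row A2-177. Sequel of A2-171 `ComplexTorusDivisorMultiplicitySingularPoints` (`mult_le_divisorMultAt`:
`mult_C(D) ≤ mult_x(D)` on `C`; `divisorMultAt_eq_mult_of_mem_regularLocus`: equality at the regular points
of `|D|` on `C`; `subset_closure_regularLocus_inter`: those are dense in `C`) and A2-174
`ComplexTorusDivisorMultiplicityStrata` (`isClosed_setOf_le_divisorMultAt`, the strata). Theorems only;
no definition, no named fact.

Sources, VERBATIM. E. M. Chirka, *Complex Analytic Sets* (1989), §1.5 (p. 11): "Let `Z_f = ∪ S_α` be the
decomposition into irreducible components […] the function `ord_z f` is constant on `S_α ∖ ∪_{β ≠ α} S_β`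
[…] this constant `m_α` is called the multiplicity of the component"; "`ord_z f ≥ m_α` for all `z ∈ S_α`"
(upper semicontinuity). P. Griffiths, J. Harris, *Principles of Algebraic Geometry* (1978), Ch. 1 §1
(p. 130): "`g = f^a · h` […] the order `ord_{V,p}(g) = a` is independent of `p`". H. Lange, *Abelian
Varieties over the Complex Numbers* (2023), §2.1.1 (p. 78: "`D = Σ nᵢ Dᵢ`"), §2.3.4 (p. 105 L20:
`mult_x(D)`). S. Grushevsky, *The Schottky problem* (MSRI Publ. 59, 2012), §5 [held `paper:arxiv-1009.0369`
p. 11 L20]: "Of course we have `N_{g−1,g} = ∅`" (`N_{k,g} = {dim Sing Θ ≥ k}`: the singular locus of a theta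
divisor contains no component of `Θ`).

## Contents (`D ∈ |L(H, χ)|`, `C` with `mult_C(D) ≠ 0`, i.e. an irreducible component of `|D|`)

* §1 `nonempty_regularLocus_inter` (`reg|D| ∩ C ≠ ∅`), **`exists_mem_divisorMultAt_eq_mult`** (the generic
  value is attained), **`iInf_divisorMultAt_eq_mult`** (`mult_C(D) = min_{x ∈ C} mult_x(D)`),
  **`subset_setOf_le_divisorMultAt_iff`** (`C ⊆ {mult ≥ k} ⟺ mult_C(D) ≥ k`), `subset_setOf_two_le_divisorMultAt_iff`,
  `subset_closure_setOf_divisorMultAt_eq_mult` (the generic stratum `{x ∈ C : mult_x = mult_C}` is dense in `C`),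
  `exists_isOpen_inter_eq_setOf_divisorMultAt_eq_mult` (and open in `C`), `iInf_divisorMultAt_eq_zero`
  (`min_X mult_x(D) = 0`: `|D| ≠ X`).
* §2 reduced divisors, `N_{g−1} = ∅`: **`not_subset_setOf_two_le_divisorMultAt`** (no component of a reduced `D`
  lies in `{mult ≥ 2}`), **`not_subset_singularLocus_support`** (nor in `sng|D|`),
  **`setOf_two_le_divisorMultAt_ssubset_support`** (`{mult ≥ 2} ⊊ |D|` for reduced `D ≠ 0`),
  **`IsPrincipalPolarization.not_subset_singularLocus`** ("`N_{g−1,g} = ∅`": `Sing Θ` contains no component of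
  `Θ` on any p.p.a.v.).

## What is NOT here

* `dim Sing D ≤ dim D − 1` as a dimension statement for arbitrary analytic sets (the tree's `HasPureDim` has no
  "dimension ≤" for non-pure sets); the constancy of `ord_z f` on `S_α ∖ ∪_{β≠α} S_β` beyond the regular points.

## References

* [Chirka1989] E. M. Chirka, *Complex Analytic Sets* (1989), §1.5 (p. 11), §8.1.
* [GriffithsHarris1978] P. Griffiths, J. Harris, *Principles of Algebraic Geometry* (1978), Ch. 1 §1 (p. 130).
* [Lange2023AbelianVarietiesComplex] H. Lange, *Abelian Varieties over the Complex Numbers* (2023), §2.1.1 (p. 78),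
  §2.3.4 (p. 105 L20).
* [Grushevsky2012SchottkyProblem] S. Grushevsky, *The Schottky problem*, MSRI Publ. 59 (2012), §5 (p. 11 L20), Def. 5.3.
-/

noncomputable section

open scoped Manifold Topology
open Set Function Module

namespace Literature.Geometry.Kaehler

universe u

namespace ComplexTorus

section Torus

variable {ι : Type*} [Fintype ι] {E : Type u} [NormedAddCommGroup E] [InnerProductSpace ℂ E]
  [FiniteDimensional ℂ E] {Φ : (ι → ℝ) ≃L[ℝ] E} {d : ℕ} {n : ℕ} (e : Fin n ≃ ι) (h : 2 * d + 2 = n)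
  {η : E [⋀^Fin 2]→L[ℝ] ℝ} {χ : (ι → ℤ) → ℂ}

/-! ### §1 `mult_C(D) = min_{x ∈ C} mult_x(D)` -/

include e h in
/-- **A component of `|D|` contains regular points of `|D|`** (they are dense in it).
[cite: Chirka1989, §1.5 (p. 11) and §2.3] [cite: GriffithsHarris1978, Ch. 1 §1 (p. 130)] -/
theorem nonempty_regularLocus_inter (hη : IsNSForm Φ η) (hχ : IsSemicharacter Φ η χ)
    {D : HolomorphicChain 𝓘(ℂ, E) (ComplexTorus Φ) d} (hD : D ∈ linearSystem Φ d η χ)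
    {C : Set (ComplexTorus Φ)} (hC : D.mult C ≠ 0) : (regularLocus 𝓘(ℂ, E) D.support ∩ C).Nonempty := by
  have hdense := subset_closure_regularLocus_inter e h hη hχ hD hC
  obtain ⟨ϑ, hϑ, hϑ0, rfl⟩ := hD
  obtain ⟨hCc, -⟩ := isIrreducibleComponent_and_mult_eq_of_mult_ne_zero e h hη hχ hϑ hϑ0 hC
  obtain ⟨y, hy⟩ := hCc.nonempty
  by_contra hempty
  rw [not_nonempty_iff_eq_empty] at hempty
  rw [hempty, closure_empty] at hdense
  exact hdense hy

include e h in
/-- **The generic multiplicity is attained: some `x ∈ C` has `mult_x(D) = mult_C(D)`** (any regular point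
of `|D|` on `C`). [cite: GriffithsHarris1978, Ch. 1 §1 (p. 130: "`ord_{V,p}(g) = a` is independent of `p`")] [cite: Chirka1989, §1.5 (p. 11)] -/
theorem exists_mem_divisorMultAt_eq_mult (hη : IsNSForm Φ η) (hχ : IsSemicharacter Φ η χ)
    {D : HolomorphicChain 𝓘(ℂ, E) (ComplexTorus Φ) d} (hD : D ∈ linearSystem Φ d η χ)
    {C : Set (ComplexTorus Φ)} (hC : D.mult C ≠ 0) :
    ∃ x ∈ C, divisorMultAt Φ d D x = ((D.mult C).toNat : ℕ∞) := by
  obtain ⟨x, hxreg, hxC⟩ := nonempty_regularLocus_inter e h hη hχ hD hC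
  exact ⟨x, hxC, divisorMultAt_eq_mult_of_mem_regularLocus e h hη hχ hD hC hxC hxreg⟩

include e h in
/-- **`mult_C(D) = min_{x ∈ C} mult_x(D)`**: the multiplicity of `D` along a component `C` is the minimum
(the generic value) of the point multiplicities on `C` ("`ord_z f ≥ m_α` on `S_α`", with equality off the
other components). [cite: Chirka1989, §1.5 (p. 11)] [cite: GriffithsHarris1978, Ch. 1 §1 (p. 130)] [cite: Lange2023AbelianVarietiesComplex, §2.1.1 (p. 78) and §2.3.4 (p. 105 L20)] -/
theorem iInf_divisorMultAt_eq_mult (hη : IsNSForm Φ η) (hχ : IsSemicharacter Φ η χ)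
    {D : HolomorphicChain 𝓘(ℂ, E) (ComplexTorus Φ) d} (hD : D ∈ linearSystem Φ d η χ)
    {C : Set (ComplexTorus Φ)} (hC : D.mult C ≠ 0) :
    ⨅ x ∈ C, divisorMultAt Φ d D x = ((D.mult C).toNat : ℕ∞) := by
  refine le_antisymm ?_ (le_iInf₂ fun x hxC => mult_le_divisorMultAt e h hη hχ hD hxC)
  obtain ⟨x, hxC, hx⟩ := exists_mem_divisorMultAt_eq_mult e h hη hχ hD hC
  exact (iInf₂_le x hxC).trans hx.le

include e h in
/-- **`C ⊆ {x : mult_x(D) ≥ k} ⟺ mult_C(D) ≥ k`** for a component `C` of `|D|`. [cite: Chirka1989, §1.5 (p. 11)] [cite: GriffithsHarris1978, Ch. 1 §1 (p. 130)] -/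
theorem subset_setOf_le_divisorMultAt_iff (hη : IsNSForm Φ η) (hχ : IsSemicharacter Φ η χ)
    {D : HolomorphicChain 𝓘(ℂ, E) (ComplexTorus Φ) d} (hD : D ∈ linearSystem Φ d η χ)
    {C : Set (ComplexTorus Φ)} (hC : D.mult C ≠ 0) {k : ℕ} :
    C ⊆ {x | (k : ℕ∞) ≤ divisorMultAt Φ d D x} ↔ k ≤ (D.mult C).toNat := by
  constructor
  · intro hsub
    obtain ⟨x, hxC, hx⟩ := exists_mem_divisorMultAt_eq_mult e h hη hχ hD hC
    have := hsub hxC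
    rw [mem_setOf_eq, hx] at this
    exact_mod_cast this
  · intro hk x hxC
    exact le_trans (by exact_mod_cast hk) (mult_le_divisorMultAt e h hη hχ hD hxC)

include e h in
/-- `C ⊆ Sing D = {mult ≥ 2} ⟺ mult_C(D) ≥ 2` (a component consists of points of multiplicity `≥ 2` iff it
is a multiple component). [cite: Chirka1989, §1.5 (p. 11)] [cite: GriffithsHarris1978, Ch. 1 §1 (p. 130)] -/
theorem subset_setOf_two_le_divisorMultAt_iff (hη : IsNSForm Φ η) (hχ : IsSemicharacter Φ η χ)
    {D : HolomorphicChain 𝓘(ℂ, E) (ComplexTorus Φ) d} (hD : D ∈ linearSystem Φ d η χ)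
    {C : Set (ComplexTorus Φ)} (hC : D.mult C ≠ 0) :
    C ⊆ {x | 2 ≤ divisorMultAt Φ d D x} ↔ 2 ≤ D.mult C := by
  have h2 := subset_setOf_le_divisorMultAt_iff e h hη hχ hD hC (k := 2)
  rw [Nat.cast_ofNat] at h2
  rw [h2]
  omega

include e h in
/-- **The generic stratum `{x ∈ C : mult_x(D) = mult_C(D)}` is dense in `C`** (it contains the regular
points of `|D|` on `C`). [cite: Chirka1989, §1.5 (p. 11: "`ord_z f` is constant on `S_α ∖ ∪_{β≠α} S_β`")] [cite: GriffithsHarris1978, Ch. 1 §1 (p. 130)] -/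
theorem subset_closure_setOf_divisorMultAt_eq_mult (hη : IsNSForm Φ η) (hχ : IsSemicharacter Φ η χ)
    {D : HolomorphicChain 𝓘(ℂ, E) (ComplexTorus Φ) d} (hD : D ∈ linearSystem Φ d η χ)
    {C : Set (ComplexTorus Φ)} (hC : D.mult C ≠ 0) :
    C ⊆ closure {x ∈ C | divisorMultAt Φ d D x = ((D.mult C).toNat : ℕ∞)} := by
  refine (subset_closure_regularLocus_inter e h hη hχ hD hC).trans (closure_mono fun x hx => ?_)
  exact ⟨hx.2, divisorMultAt_eq_mult_of_mem_regularLocus e h hη hχ hD hC hx.2 hx.1⟩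

include e h in
/-- **The generic stratum is open in `C`**: `{x ∈ C : mult_x(D) = mult_C(D)} = U ∩ C` with
`U = {x : mult_x(D) < mult_C(D) + 1}` open (upper semicontinuity). [cite: Chirka1989, §1.5 (p. 11: "sets of smaller values `ord_z f < t` are open")] -/
theorem exists_isOpen_inter_eq_setOf_divisorMultAt_eq_mult (hη : IsNSForm Φ η) (hχ : IsSemicharacter Φ η χ)
    {D : HolomorphicChain 𝓘(ℂ, E) (ComplexTorus Φ) d} (hD : D ∈ linearSystem Φ d η χ)
    (C : Set (ComplexTorus Φ)) :
    ∃ U : Set (ComplexTorus Φ), IsOpen U ∧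
      U ∩ C = {x ∈ C | divisorMultAt Φ d D x = ((D.mult C).toNat : ℕ∞)} := by
  refine ⟨{x | (((D.mult C).toNat + 1 : ℕ) : ℕ∞) ≤ divisorMultAt Φ d D x}ᶜ,
    (isClosed_setOf_le_divisorMultAt e h hη hχ hD _).isOpen_compl, ?_⟩
  ext x
  simp only [mem_inter_iff, mem_compl_iff, mem_setOf_eq, not_le]
  constructor
  · rintro ⟨hlt, hxC⟩
    refine ⟨hxC, le_antisymm ?_ (mult_le_divisorMultAt e h hη hχ hD hxC)⟩
    obtain ⟨m, hm⟩ := ENat.ne_top_iff_exists.1 (divisorMultAt_ne_top e h hη hχ hD x)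
    rw [← hm] at hlt ⊢
    have := ENat.coe_lt_coe.1 hlt
    exact ENat.coe_le_coe.2 (by omega)
  · rintro ⟨hxC, hx⟩
    refine ⟨?_, hxC⟩
    rw [hx]
    exact ENat.coe_lt_coe.2 (Nat.lt_succ_self _)

include e h in
/-- `min_{x ∈ X} mult_x(D) = 0`: the support of `D ∈ |L(H, χ)|` is not all of `X` (`ϑ ≢ 0`). [cite: Lange2023AbelianVarietiesComplex, §2.3.4 (p. 105 L20) and §2.1.1 (p. 78)] -/
theorem iInf_divisorMultAt_eq_zero (hη : IsNSForm Φ η) (hχ : IsSemicharacter Φ η χ)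
    {D : HolomorphicChain 𝓘(ℂ, E) (ComplexTorus Φ) d} (hD : D ∈ linearSystem Φ d η χ) :
    ⨅ x, divisorMultAt Φ d D x = 0 := by
  obtain ⟨ϑ, hϑ, hϑ0, rfl⟩ := hD
  obtain ⟨v, hv⟩ := Function.ne_iff.1 hϑ0
  refine le_antisymm ((iInf_le _ (cover Φ v)).trans ?_) bot_le
  rw [(divisorMultAt_eq_zero_iff e h hη hχ ⟨ϑ, hϑ, hϑ0, rfl⟩ (cover Φ v)).2
    (fun hmem => hv ((cover_mem_support_divisorChain_iff Φ d e h hη hχ hϑ hϑ0 v).1 hmem))]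

/-! ### §2 Reduced divisors: no component lies in `Sing D` (`N_{g−1,g} = ∅`) -/

include e h in
/-- **No component of a reduced divisor lies in `{mult ≥ 2}`** (its generic multiplicity is `1`).
[cite: Grushevsky2012SchottkyProblem, §5 (p. 11 L20: "Of course we have `N_{g−1,g} = ∅`")] [cite: Chirka1989, §1.5 (p. 11)] -/
theorem not_subset_setOf_two_le_divisorMultAt (hη : IsNSForm Φ η) (hχ : IsSemicharacter Φ η χ)
    {D : HolomorphicChain 𝓘(ℂ, E) (ComplexTorus Φ) d} (hD : D ∈ linearSystem Φ d η χ)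
    (hred : ∀ C, D.mult C ≤ 1) {C : Set (ComplexTorus Φ)} (hC : D.mult C ≠ 0) :
    ¬C ⊆ {x | 2 ≤ divisorMultAt Φ d D x} := by
  rw [subset_setOf_two_le_divisorMultAt_iff e h hη hχ hD hC]
  have := hred C
  omega

include e h in
/-- **No component of a reduced divisor lies in `sng|D|`.** [cite: Grushevsky2012SchottkyProblem, §5 (p. 11 L20: "`N_{g−1,g} = ∅`")] [cite: Chirka1989, §2.9 Prop. 2 (p. 27: "`{(df)_z = 0}` is nowhere dense in `A`")] -/
theorem not_subset_singularLocus_support (hη : IsNSForm Φ η) (hχ : IsSemicharacter Φ η χ)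
    {D : HolomorphicChain 𝓘(ℂ, E) (ComplexTorus Φ) d} (hD : D ∈ linearSystem Φ d η χ)
    (hred : ∀ C, D.mult C ≤ 1) {C : Set (ComplexTorus Φ)} (hC : D.mult C ≠ 0) :
    ¬C ⊆ singularLocus 𝓘(ℂ, E) D.support := by
  rw [singularLocus_support_eq_of_forall_mult_le_one e h hη hχ hD hred]
  exact fun hsub => not_subset_setOf_two_le_divisorMultAt e h hη hχ hD hred hC fun x hx => (hsub hx).2

include e h in
/-- **`{mult ≥ 2} ⊊ |D|` for a reduced non-zero `D ∈ |L(H, χ)|`** (`Sing D` is a proper subset of the support).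
[cite: Grushevsky2012SchottkyProblem, §5 (p. 11 L20)] [cite: Chirka1989, §2.9 Prop. 2 (p. 27)] -/
theorem setOf_two_le_divisorMultAt_ssubset_support (hη : IsNSForm Φ η) (hχ : IsSemicharacter Φ η χ)
    {D : HolomorphicChain 𝓘(ℂ, E) (ComplexTorus Φ) d} (hD : D ∈ linearSystem Φ d η χ)
    (hred : ∀ C, D.mult C ≤ 1) (hne : D.support.Nonempty) :
    {x | 2 ≤ divisorMultAt Φ d D x} ⊂ D.support := by
  refine ssubset_of_subset_of_ne (fun x hx => mem_support_of_two_le_divisorMultAt e h hη hχ hD hx) fun hEq => ?_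
  obtain ⟨x, hx⟩ := hne
  obtain ⟨C, hC, hxC⟩ := HolomorphicChain.mem_support_iff.1 hx
  refine not_subset_setOf_two_le_divisorMultAt e h hη hχ hD hred hC fun y hyC => ?_
  rw [hEq]
  exact HolomorphicChain.mem_support_iff.2 ⟨C, hC, hyC⟩

include e h in
/-- **`N_{g−1,g} = ∅`: the singular locus `Sing Θ` of a principally polarised abelian variety contains no
component of `Θ`** (`Θ = (ϑ)` is reduced, A2-144/A2-171). [cite: Grushevsky2012SchottkyProblem, §5 (p. 11 L20: "Of course we have `N_{g−1,g} = ∅`") and Def. 5.3] -/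
theorem IsPrincipalPolarization.not_subset_singularLocus [DecidableEq ι] (hP : IsPrincipalPolarization Φ η)
    (hχ : IsSemicharacter Φ η χ) {ϑ : E → ℂ} (hϑ : ϑ ∈ thetaFunctions Φ (canonicalFactor Φ η χ))
    (hϑ0 : ϑ ≠ 0) {C : Set (ComplexTorus Φ)} (hC : (divisorChain Φ d ϑ).mult C ≠ 0) :
    ¬C ⊆ singularLocus 𝓘(ℂ, E) (divisorChain Φ d ϑ).support := by
  letI : MeasurableSpace E := borel E
  haveI : BorelSpace E := ⟨rfl⟩
  have hη : IsNSForm Φ η := hP.isRiemannForm.isNSForm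
  have hred := (forall_mult_le_one_iff_isMinimalDefiningOn e h hη hχ hϑ hϑ0).2
    (hP.isMinimalDefiningOn_of_thetaFunction Φ hχ hϑ hϑ0)
  exact not_subset_singularLocus_support e h hη hχ ⟨ϑ, hϑ, hϑ0, rfl⟩ hred hC

include e h in
/-- `Sing Θ ⊊ Θ` on every p.p.a.v. with `Θ ≠ 0`. [cite: Grushevsky2012SchottkyProblem, §5 (p. 11 L20) and Def. 5.3] -/
theorem IsPrincipalPolarization.setOf_two_le_divisorMultAt_ssubset_support [DecidableEq ι]
    (hP : IsPrincipalPolarization Φ η) (hχ : IsSemicharacter Φ η χ) {ϑ : E → ℂ}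
    (hϑ : ϑ ∈ thetaFunctions Φ (canonicalFactor Φ η χ)) (hϑ0 : ϑ ≠ 0)
    (hne : (divisorChain Φ d ϑ).support.Nonempty) :
    {x | 2 ≤ divisorMultAt Φ d (divisorChain Φ d ϑ) x} ⊂ (divisorChain Φ d ϑ).support := by
  letI : MeasurableSpace E := borel E
  haveI : BorelSpace E := ⟨rfl⟩
  have hη : IsNSForm Φ η := hP.isRiemannForm.isNSForm
  have hred := (forall_mult_le_one_iff_isMinimalDefiningOn e h hη hχ hϑ hϑ0).2
    (hP.isMinimalDefiningOn_of_thetaFunction Φ hχ hϑ hϑ0)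
  exact ComplexTorus.setOf_two_le_divisorMultAt_ssubset_support e h hη hχ ⟨ϑ, hϑ, hϑ0, rfl⟩ hred hne

end Torus

end ComplexTorus

end Literature.Geometry.Kaehler
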